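import Summits.KontsevichZagierPeriods.KontsevichZagierPeriods.Theses.SymplecticScissors
import Literature.NumberTheory.Transcendental.AyoubPeriodSeries
import Literature.NumberTheory.Transcendental.AyoubPeriodSeriesKernel
import Literature.NumberTheory.Transcendental.AyoubPeriodSeriesPiAlgebraic
import Literature.NumberTheory.Transcendental.AyoubPeriodSeriesLocalizing
import Summits.KontsevichZagierPeriods.KontsevichZagierPeriods.Theorems.UnfoldedStokesStokesGenerationStubSpanToRepsAuxCoeff
import Mathlib.RingTheory.MvPowerSeries.Rename
import Mathlib.RingTheory.MvPowerSeries.Substitution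

/-!
# `TypeAGeneration` (stmt-KontsevichZagierPeriods-18392), line `Sketch`: stub `stub_roomStepCongruence`

The ROOM STEP of the radius-amplification engine of the line `Sketch` (card `stokes-compiler`) for
Ayoub's Conjecture 1.1 (Ann. of Math. 181 (2015)) = Fresán's Conjecture 3.5, typed over
`Literature/NumberTheory/Transcendental/AyoubPeriodSeries.lean` (`AyoubRel.Oan σ = 𝒪_{k-alg}(𝔻̄^∞)`,
`AyoubRel.pdz i = ∂/∂zᵢ`, `AyoubRel.restrC i c = (·)|_{zᵢ = c}`,
`AyoubRel.relAC i = ∂/∂zᵢ − (·)|_{zᵢ=1} + (·)|_{zᵢ=0}`, `AyoubRel.kSpan σ`).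

**The dilation–subdivision congruence.** For `F ∈ 𝒪_{k-alg}(𝔻̄^∞)` free of `z_j` (`i ≠ j`), a
rational `μ`, and `T = F(zᵢ(1 − μ z_j), w)` (`MvPowerSeries.subst` along `zᵢ ↦ zᵢ − μ zᵢ z_j`) assumed
to lie in `𝒪_{k-alg}(𝔻̄^∞)`: `F − ((1 − μ) · F((1 − μ) zᵢ, w) + μ · T|_{zᵢ=1})` lies in the `k`-span
of the type (a) elements. Certificate (the closed 1-form `F(v, w) dv`, `v = zᵢ(1 − μ z_j)`; J. Ayoub,
Ann. of Math. 181 (2015) Rem. 1.5 style): with `A = (1 − μ z_j) T` and `B = −μ zᵢ T`,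
`relAC j A − relAC i B = F − ((1 − μ) · F((1 − μ) zᵢ, w) + μ · T|_{zᵢ=1})`, coefficientwise from
`T_{β + n eᵢ + m e_j} = F_{β + n eᵢ} C(n, m) (−μ)^m` (`s2_coeff_subst`): `A|_{z_j=1} = (1 − μ) F((1−μ)zᵢ, w)`
(binomial theorem), `A|_{z_j=0} = F`, `B|_{zᵢ=1} = −μ T|_{zᵢ=1}`, `B|_{zᵢ=0} = 0`, `∂_j A = ∂ᵢ B`
(Pascal's rule); `A, B ∈ 𝒪_{k-alg}(𝔻̄^∞)` as products of `T` with rational polynomials. No definition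
is introduced.
-/

noncomputable section

-- `Summit.KontsevichZagierPeriods.KontsevichZagierPeriods.…` is the tree's mandated layout (single-conjunct summit).
set_option linter.dupNamespace false

namespace Summit.KontsevichZagierPeriods.KontsevichZagierPeriods.TypeAGenerationLine

open Finsupp MvPowerSeries
open Literature.NumberTheory.Transcendental
open Literature.NumberTheory.Transcendental.AyoubRel
open Summit.KontsevichZagierPeriods.KontsevichZagierPeriods.Theses.SymplecticScissors (TypeAGeneration)

/-! ## The substitution `zᵢ ↦ zᵢ(1 − c z_j)` and the coefficients of `T = F(zᵢ(1 − c z_j), w)` -/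

section Subst

variable (i j : ℕ) (c : ℂ)

/-- The substitution `zᵢ ↦ zᵢ − c zᵢ z_j` (identity on the other variables) is admissible: no
constant terms, and a given monomial occurs in only finitely many of the substituted series.
[folklore] -/
theorem s2_hasSubst :
    HasSubst (fun l : ℕ => if l = i then (X i - C c * (X i * X j) : CSeries) else X l) := by
  classical
  refine ⟨fun l => ?_, fun d => ?_⟩
  · have h0 : constantCoeff (if l = i then (X i - C c * (X i * X j) : CSeries) else X l) = 0 := by
      split_ifs
      · simp only [map_sub, map_mul, constantCoeff_X, mul_zero, sub_zero]
      · exact constantCoeff_X l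
    show IsNilpotent (constantCoeff (if l = i then (X i - C c * (X i * X j) : CSeries) else X l))
    rw [h0]
    exact IsNilpotent.zero
  · refine (Finset.finite_toSet (insert i d.support)).subset fun l hl => ?_
    simp only [Set.mem_setOf_eq] at hl
    rw [Finset.coe_insert, Set.mem_insert_iff, Finset.mem_coe]
    by_cases hli : l = i
    · exact Or.inl hli
    · right
      rw [if_neg hli, coeff_X] at hl
      by_cases hd : d = single l 1
      · rw [hd, mem_support_iff, single_eq_same]
        exact one_ne_zero
      · exact absurd (if_neg hd) hl

/-- The substituted monomials: `∏ₗ aₗ^{dₗ} = z^d · (1 − c z_j)^{dᵢ}`. [folklore] -/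
theorem s2_prod_pow_eq (d : ℕ →₀ ℕ) :
    (d.prod fun l n => (if l = i then (X i - C c * (X i * X j) : CSeries) else X l) ^ n) =
      monomial d 1 * (1 - C c * X j) ^ (d i) := by
  classical
  have hfac : ∀ l n, (if l = i then (X i - C c * (X i * X j) : CSeries) else X l) ^ n =
      (X l) ^ n * (if l = i then ((1 : CSeries) - C c * X j) ^ n else 1) := by
    intro l n
    split_ifs with h
    · rw [h, ← mul_pow]
      congr 1
      ring
    · rw [mul_one]
  simp only [hfac]
  rw [Finsupp.prod_mul, ← monomial_one_eq]
  congr 1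
  simp only [Finsupp.prod, Finset.prod_ite_eq']
  split_ifs with h
  · rfl
  · rw [notMem_support_iff.mp h, pow_zero]

/-- Coefficients of `(1 − c z_j)^N` (binomial theorem): `C(N, m) (−c)^m` at `m e_j`, zero off the
`z_j`-axis. [folklore] -/
theorem s2_coeff_one_sub_pow (N : ℕ) (x : ℕ →₀ ℕ) :
    coeff x (((1 : CSeries) - C c * X j) ^ N) =
      if x = single j (x j) then ((N.choose (x j) : ℕ) : ℂ) * (-c) ^ (x j) else 0 := by
  classical
  have h1 : ((1 : CSeries) - C c * X j) = monomial (single j 1) (-c) + 1 := by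
    rw [add_comm, sub_eq_add_neg]
    congr 1
    ext y
    rw [map_neg, coeff_C_mul, coeff_X, coeff_monomial]
    split_ifs <;> ring
  rw [h1, add_pow, map_sum]
  simp only [one_pow, mul_one, monomial_pow, smul_single_one, ← map_natCast (C : ℂ →+* CSeries),
    coeff_mul_C, coeff_monomial]
  split_ifs with hx
  · have heq : ∀ m : ℕ, (x = single j m) ↔ (x j = m) := fun m =>
      ⟨fun h => by rw [h, single_eq_same], fun h => by rw [← h]; exact hx⟩
    simp only [heq, ite_mul, zero_mul, Finset.sum_ite_eq, Finset.mem_range]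
    split_ifs with hlt
    · exact mul_comm _ _
    · rw [Nat.choose_eq_zero_of_lt (by omega), Nat.cast_zero, zero_mul]
  · refine Finset.sum_eq_zero fun m _ => ?_
    rw [if_neg, zero_mul]
    rintro rfl
    exact hx (by rw [single_eq_same])

/-- **Coefficients of `T = F(zᵢ(1 − c z_j), w)`** for `F` free of `z_j`, `i ≠ j`:
`T_e = F_{e∖j} · C(eᵢ, e_j) (−c)^{e_j}` (`z^{β + n eᵢ} ↦ z^{β + n eᵢ} (1 − c z_j)^n`). [folklore] -/
theorem s2_coeff_subst {i j : ℕ} (hij : i ≠ j) {F : CSeries}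
    (hFj : ∀ d : ℕ →₀ ℕ, d j ≠ 0 → coeff d F = 0) (c : ℂ) (e : ℕ →₀ ℕ) :
    coeff e (MvPowerSeries.subst
      (fun l : ℕ => if l = i then (X i - C c * (X i * X j) : CSeries) else X l) F) =
      coeff (e.erase j) F * ((e i).choose (e j) : ℂ) * (-c) ^ (e j) := by
  classical
  have hej : e - e.erase j = single j (e j) := by
    ext l
    rcases eq_or_ne l j with rfl | hl
    · rw [Finsupp.tsub_apply, erase_same, tsub_zero, single_eq_same]
    · rw [Finsupp.tsub_apply, erase_ne hl, tsub_self, single_eq_of_ne hl]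
  have hle : e.erase j ≤ e := Finsupp.le_def.mpr fun l => by
    rcases eq_or_ne l j with rfl | hl
    · exact (erase_same (f := e)).trans_le (Nat.zero_le _)
    · rw [erase_ne hl]
  rw [coeff_subst (s2_hasSubst i j c) F e, finsum_eq_single _ (e.erase j)]
  · rw [s2_prod_pow_eq, coeff_monomial_mul, if_pos hle, one_mul, hej, s2_coeff_one_sub_pow,
      if_pos (by rw [single_eq_same]), single_eq_same, erase_ne hij, smul_eq_mul, mul_assoc]
  · intro d hd
    by_cases hF0 : coeff d F = 0
    · rw [hF0, zero_smul]
    have hdj : d j = 0 := by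
      by_contra h
      exact hF0 (hFj d h)
    rw [s2_prod_pow_eq, coeff_monomial_mul]
    split_ifs with hde
    · rw [one_mul, s2_coeff_one_sub_pow]
      split_ifs with hx
      · exfalso
        apply hd
        have he : e = d + single j ((e - d) j) := by rw [← hx, add_tsub_cancel_of_le hde]
        rw [he, erase_add, erase_single, add_zero, erase_of_notMem_support]
        rwa [notMem_support_iff]
      · rw [smul_zero]
    · rw [smul_zero]

end Subst

/-! ## The faces and derivatives of `A = (1 − c z_j) T` and `B = −c zᵢ T` -/

section Faces

/-- `coeff_{b + eᵢ} (zᵢ T) = coeff_b T`. [folklore] -/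
theorem s2_coeff_X_mul_add_single (i : ℕ) (T : CSeries) (b : ℕ →₀ ℕ) :
    coeff (b + single i 1) (X i * T) = coeff b T := by
  rw [X_def, add_comm, coeff_add_monomial_mul, one_mul]

/-- `coeff_b (zᵢ T) = 0` when `bᵢ = 0`. [folklore] -/
theorem s2_coeff_X_mul_of_zero (T : CSeries) {i : ℕ} {b : ℕ →₀ ℕ} (hb : b i = 0) :
    coeff b (X i * T) = 0 := by
  classical
  rw [X_def, coeff_monomial_mul, if_neg]
  rw [single_le_iff, hb]
  exact Nat.not_succ_le_zero 0

/-- `(zᵢ T)|_{zᵢ=1} = T|_{zᵢ=1}` (shift of the fibre sums; no convergence needed). [folklore] -/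
theorem s2_restrC_one_X_mul (i : ℕ) (T : CSeries) : restrC i 1 (X i * T) = restrC i 1 T := by
  ext b
  rw [StokesGenerationLine.coeff_restrC, StokesGenerationLine.coeff_restrC]
  split_ifs with hb
  · simp only [one_pow, mul_one]
    have hsupp : Function.support (fun n : ℕ => coeff (b + single i n) (X i * T)) ⊆
        Set.range Nat.succ := by
      intro n hn
      rw [Nat.range_succ, Set.mem_setOf_eq]
      refine Nat.pos_of_ne_zero ?_
      rintro rfl
      refine hn ?_
      show coeff (b + single i 0) (X i * T) = 0
      rw [single_zero, add_zero]
      exact s2_coeff_X_mul_of_zero T hb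
    rw [← Nat.succ_injective.tsum_eq hsupp]
    refine tsum_congr fun n => ?_
    rw [Nat.succ_eq_add_one, single_add, ← add_assoc, s2_coeff_X_mul_add_single]
  · rfl

/-- `(zᵢ T)|_{zᵢ=0} = 0`. [folklore] -/
theorem s2_restrC_zero_X_mul (i : ℕ) (T : CSeries) : restrC i 0 (X i * T) = 0 := by
  ext b
  rw [StokesGenerationLine.coeff_restrC, map_zero]
  split_ifs with hb
  · rw [tsum_eq_single 0 fun n hn => by rw [zero_pow hn, mul_zero], pow_zero, mul_one,
      single_zero, add_zero]
    exact s2_coeff_X_mul_of_zero T hb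
  · rfl

variable {F T : CSeries} {i j : ℕ} {c : ℂ}

/-- Coefficients of `A = (1 − c z_j) T`: `A_e = F_{e∖j} C(eᵢ + 1, e_j) (−c)^{e_j}` (Pascal's rule).
[folklore] -/
theorem s2_coeff_A (hij : i ≠ j)
    (hT : ∀ e : ℕ →₀ ℕ, coeff e T = coeff (e.erase j) F * ((e i).choose (e j) : ℂ) * (-c) ^ (e j))
    (e : ℕ →₀ ℕ) :
    coeff e ((1 - C c * X j) * T) =
      coeff (e.erase j) F * ((e i + 1).choose (e j) : ℂ) * (-c) ^ (e j) := by
  classical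
  rw [sub_mul, one_mul, map_sub, mul_assoc, coeff_C_mul, X_def, coeff_monomial_mul, hT e]
  cases h : e j with
  | zero =>
    rw [if_neg (by rw [single_le_iff, h]; exact Nat.not_succ_le_zero 0), mul_zero, sub_zero,
      Nat.choose_zero_right, Nat.choose_zero_right]
  | succ m =>
    have hle : single j 1 ≤ e := single_le_iff.mpr (by omega)
    have h1 : (e - single j 1).erase j = e.erase j := by
      ext l
      rcases eq_or_ne l j with rfl | hl
      · rw [erase_same, erase_same]
      · rw [erase_ne hl, erase_ne hl, Finsupp.tsub_apply, single_eq_of_ne hl, tsub_zero]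
    have h2 : (e - single j 1 : ℕ →₀ ℕ) i = e i := by
      rw [Finsupp.tsub_apply, single_eq_of_ne hij, tsub_zero]
    have h3 : (e - single j 1 : ℕ →₀ ℕ) j = m := by
      rw [Finsupp.tsub_apply, single_eq_same, h, Nat.add_sub_cancel]
    rw [if_pos hle, one_mul, hT, h1, h2, h3, Nat.choose_succ_succ']
    push_cast
    ring

/-- `∂_j A = −c ∂ᵢ(zᵢ T)` (`(m+1) C(n+1, m+1) = (n+1) C(n, m)`). [folklore] -/
theorem s2_pdz_A (hij : i ≠ j)
    (hT : ∀ e : ℕ →₀ ℕ, coeff e T = coeff (e.erase j) F * ((e i).choose (e j) : ℂ) * (-c) ^ (e j)) :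
    pdz j ((1 - C c * X j) * T) = (-c) • pdz i (X i * T) := by
  ext b
  rw [StokesGenerationLine.coeff_pdz, coeff_smul, StokesGenerationLine.coeff_pdz,
    s2_coeff_A hij hT, s2_coeff_X_mul_add_single, hT b, erase_add_single_self]
  simp only [Finsupp.add_apply, single_eq_same, single_eq_of_ne hij, add_zero]
  have h' : ((b i : ℂ) + 1) * ((b i).choose (b j) : ℂ) =
      (((b i + 1).choose (b j + 1) : ℕ) : ℂ) * ((b j : ℂ) + 1) := by
    exact_mod_cast Nat.add_one_mul_choose_eq (b i) (b j)
  linear_combination (-(coeff (b.erase j) F * (-c) ^ (b j + 1))) * h'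

/-- `A|_{z_j=1} = (1 − c) · F((1 − c) zᵢ, w)` (binomial theorem along the `z_j`-fibres, which are
finite sums). [folklore] -/
theorem s2_restrC_one_A (hij : i ≠ j) (hFj : ∀ d : ℕ →₀ ℕ, d j ≠ 0 → coeff d F = 0)
    (hT : ∀ e : ℕ →₀ ℕ, coeff e T = coeff (e.erase j) F * ((e i).choose (e j) : ℂ) * (-c) ^ (e j)) :
    restrC j 1 ((1 - C c * X j) * T) =
      (1 - c) • MvPowerSeries.rescale (Function.update (1 : ℕ → ℂ) i (1 - c)) F := by
  classical
  ext b
  rw [StokesGenerationLine.coeff_restrC, coeff_smul, coeff_rescale]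
  have hprod : (b.prod fun s m => Function.update (1 : ℕ → ℂ) i (1 - c) s ^ m) =
      (1 - c) ^ (b i) := by
    simp only [Finsupp.prod]
    rw [Finset.prod_eq_single i]
    · rw [Function.update_self]
    · intro s _ hs
      rw [Function.update_of_ne hs, Pi.one_apply, one_pow]
    · intro hi
      rw [notMem_support_iff.mp hi, pow_zero]
  rw [hprod]
  split_ifs with hb
  · have hbj : b.erase j = b := erase_of_notMem_support (by rwa [notMem_support_iff])
    have hterm : ∀ m : ℕ, coeff (b + single j m) ((1 - C c * X j) * T) * (1 : ℂ) ^ m =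
        coeff b F * (((b i + 1).choose m : ℕ) : ℂ) * (-c) ^ m := by
      intro m
      rw [one_pow, mul_one, s2_coeff_A hij hT, erase_add_single_self, hbj]
      simp only [Finsupp.add_apply, single_eq_same, single_eq_of_ne hij, hb, zero_add, add_zero]
    have hvan : ∀ m ∉ Finset.range (b i + 1 + 1),
        coeff b F * (((b i + 1).choose m : ℕ) : ℂ) * (-c) ^ m = 0 := fun m hm => by
      rw [Finset.mem_range, not_lt] at hm
      rw [Nat.choose_eq_zero_of_lt (by omega), Nat.cast_zero, mul_zero, zero_mul]
    have hsum : ∑ m ∈ Finset.range (b i + 1 + 1), (((b i + 1).choose m : ℕ) : ℂ) * (-c) ^ m =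
        (1 - c) ^ (b i + 1) := by
      rw [show (1 : ℂ) - c = -c + 1 by ring, add_pow]
      refine Finset.sum_congr rfl fun m _ => ?_
      rw [one_pow, mul_one, mul_comm]
    simp only [hterm]
    rw [tsum_eq_sum hvan]
    simp_rw [mul_assoc]
    rw [← Finset.mul_sum, hsum]
    ring
  · rw [hFj b hb, mul_zero, mul_zero]

/-- `A|_{z_j=0} = F`. [folklore] -/
theorem s2_restrC_zero_A (hij : i ≠ j) (hFj : ∀ d : ℕ →₀ ℕ, d j ≠ 0 → coeff d F = 0)
    (hT : ∀ e : ℕ →₀ ℕ, coeff e T = coeff (e.erase j) F * ((e i).choose (e j) : ℂ) * (-c) ^ (e j)) :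
    restrC j 0 ((1 - C c * X j) * T) = F := by
  classical
  ext b
  rw [StokesGenerationLine.coeff_restrC]
  split_ifs with hb
  · rw [tsum_eq_single 0 fun m hm => by rw [zero_pow hm, mul_zero], pow_zero, mul_one,
      single_zero, add_zero, s2_coeff_A hij hT, hb, Nat.choose_zero_right, Nat.cast_one, mul_one,
      pow_zero, mul_one, erase_of_notMem_support (by rwa [notMem_support_iff])]
  · exact (hFj b hb).symm

end Faces

/-! ## Membership of the certificate in `𝒪_{k-alg}(𝔻̄^∞)` -/

section Mem

variable {k : Type} [Field k] (σ : k →+* ℂ)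

/-- Rational constants are algebraic over `k` along `σ` (roots of `Y − q`). [folklore] -/
theorem s2_ratCast_algebraic (q : ℚ) :
    ∃ p : Polynomial k, p ≠ 0 ∧ Polynomial.eval₂ σ ((q : ℚ) : ℂ) p = 0 :=
  ⟨Polynomial.X - Polynomial.C (q : k), Polynomial.X_sub_C_ne_zero _, by
    rw [Polynomial.eval₂_sub, Polynomial.eval₂_X, Polynomial.eval₂_C, map_ratCast, sub_self]⟩

/-- The variables `zₗ` lie in `𝒪_{k-alg}(𝔻̄^∞)` (one variable, one coefficient, root of `Y − zₗ`).
[folklore] -/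
theorem s2_X_mem_Oan (l : ℕ) : (X l : CSeries) ∈ Oan σ := by
  classical
  refine ⟨⟨l + 1, fun a ha => ?_⟩, ⟨2, one_lt_two, ?_⟩, isAlgebraicOverRatFunc_X σ l⟩
  · obtain ⟨i', hi', hai'⟩ := ha
    rw [coeff_X, if_neg]
    rintro rfl
    rw [single_eq_of_ne (by omega : i' ≠ l)] at hai'
    exact hai' rfl
  · refine summable_of_ne_finset_zero (s := {single l 1}) fun a ha => ?_
    rw [Finset.mem_singleton] at ha
    rw [coeff_X, if_neg ha, norm_zero, zero_mul]

/-- `A = (1 − μ z_j) T ∈ 𝒪_{k-alg}(𝔻̄^∞)` for `T ∈ 𝒪_{k-alg}(𝔻̄^∞)` and rational `μ`. [folklore] -/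
theorem s2_A_mem_Oan (μ : ℚ) (j : ℕ) {T : CSeries} (hT : T ∈ Oan σ) :
    (1 - C ((μ : ℚ) : ℂ) * X j) * T ∈ Oan σ := by
  refine mul_mem_Oan σ (sub_mem_Oan σ (one_mem_Oan σ) ?_) hT
  rw [← smul_eq_C_mul]
  exact smul_mem_Oan σ (s2_ratCast_algebraic σ μ) (s2_X_mem_Oan σ j)

/-- `B = −μ zᵢ T ∈ 𝒪_{k-alg}(𝔻̄^∞)` for `T ∈ 𝒪_{k-alg}(𝔻̄^∞)` and rational `μ`. [folklore] -/
theorem s2_B_mem_Oan (μ : ℚ) (i : ℕ) {T : CSeries} (hT : T ∈ Oan σ) :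
    (-((μ : ℚ) : ℂ)) • (X i * T) ∈ Oan σ := by
  have h := s2_ratCast_algebraic σ (-μ)
  rw [Rat.cast_neg] at h
  exact smul_mem_Oan σ h (mul_mem_Oan σ (s2_X_mem_Oan σ i) hT)

end Mem

/-! ## The registered stub -/

/-- **S2 — the room step (dilation–subdivision congruence).** For `F ∈ 𝒪_{k-alg}(𝔻̄^∞)` free of
`z_j` (`i ≠ j`) and a rational `μ` such that `T = F(zᵢ(1 − μ z_j), w)` (the substitution
`zᵢ ↦ zᵢ − μ zᵢ z_j`, `MvPowerSeries.subst`) lies in `𝒪_{k-alg}(𝔻̄^∞)`: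
`F − ((1−μ) · F((1−μ) zᵢ, w) + μ · T|_{zᵢ=1}) ∈ ⟨a⟩_k`. Certificate: the closed 1-form
`F(v, w) dv`, `v = zᵢ φ(z_j)`, `φ(u) = 1 − μ u`: with `A = φ(z_j) T`, `B = −μ zᵢ T`,
`relAC j A − relAC i B` equals the left-hand side (`A|_{z_j=1} = (1−μ) F((1−μ)zᵢ, w)`,
`A|_{z_j=0} = F`, `B|_{zᵢ=1} = −μ T|_{zᵢ=1}`, `B|_{zᵢ=0} = 0`, `∂_j A = ∂ᵢ B` — coefficientwise,
`T_{β+neᵢ+me_j} = F_{β+neᵢ} C(n,m) (−μ)^m`, Pascal's rule), and `A, B ∈ 𝒪_{k-alg}(𝔻̄^∞)` as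
products of `T` with rational polynomials. [cite: Ayoub2015, Rem. 1.5] -/
theorem stub_roomStepCongruence :
    ∀ (k : Type) [Field k] [CharZero k] (σ : k →+* ℂ) (F : CSeries), F ∈ Oan σ →
      ∀ (i j : ℕ), i ≠ j → ¬ UsesVar F j → ∀ (μ : ℚ),
        MvPowerSeries.subst
            (fun l : ℕ => if l = i then (X i - C ((μ : ℚ) : ℂ) * (X i * X j) : CSeries) else X l) F ∈ Oan σ →
        F - ((((1 - μ : ℚ) : ℂ)) • MvPowerSeries.rescale (Function.update (1 : ℕ → ℂ) i ((1 - μ : ℚ) : ℂ)) F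
              + ((μ : ℚ) : ℂ) • restrC i 1
                  (MvPowerSeries.subst
                    (fun l : ℕ => if l = i then (X i - C ((μ : ℚ) : ℂ) * (X i * X j) : CSeries) else X l) F)) ∈
          kSpan σ {x : CSeries | ∃ G ∈ Oan σ, ∃ n : ℕ, x = relAC n G} := by
  intro k _ _ σ F _ i j hij hFj μ hT
  classical
  have hFj' : ∀ d : ℕ →₀ ℕ, d j ≠ 0 → coeff d F = 0 := fun d hd => by
    by_contra h
    exact hFj ⟨d, hd, h⟩
  have hA := s2_A_mem_Oan σ μ j hT
  have hB := s2_B_mem_Oan σ μ i hT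
  set c : ℂ := ((μ : ℚ) : ℂ) with hc
  set T : CSeries := MvPowerSeries.subst
    (fun l : ℕ => if l = i then (X i - C c * (X i * X j) : CSeries) else X l) F
  have hcoeff : ∀ e : ℕ →₀ ℕ,
      coeff e T = coeff (e.erase j) F * ((e i).choose (e j) : ℂ) * (-c) ^ (e j) :=
    s2_coeff_subst hij hFj' c
  have hlam : (((1 - μ : ℚ)) : ℂ) = 1 - c := by rw [hc, Rat.cast_sub, Rat.cast_one]
  rw [hlam]
  have key : F - ((1 - c) • MvPowerSeries.rescale (Function.update (1 : ℕ → ℂ) i (1 - c)) F +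
      c • restrC i 1 T) = relAC j ((1 - C c * X j) * T) - relAC i ((-c) • (X i * T)) := by
    rw [relAC_smul]
    simp only [relAC]
    rw [s2_pdz_A hij hcoeff, s2_restrC_one_A hij hFj' hcoeff, s2_restrC_zero_A hij hFj' hcoeff,
      s2_restrC_one_X_mul, s2_restrC_zero_X_mul, add_zero]
    module
  rw [key]
  exact kSpan_sub σ (subset_kSpan σ _ ⟨_, hA, j, rfl⟩) (subset_kSpan σ _ ⟨_, hB, i, rfl⟩)

end Summit.KontsevichZagierPeriods.KontsevichZagierPeriods.TypeAGenerationLine
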